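import Mathlib
import HarnessLib
import Summits.Parity.GeneralizedHardyLittlewood.Theses.LiouvilleMAD

/-!
# Disproof of `TypeIILiouville` (crux stmt-Parity-13322, route `LiouvilleMAD`) — findings

Standing disprover `refuter-cdisprove-stmt-Parity-13322-0`, cycle 1 (2026-08-16).

**Verdict so far: NO KILL — the crux resists unconditional refutation** (see §4), but three
natural mutations / strengthenings are FALSE and are proved false below (sorry-free), and the
picked negative line `Sketch` survives a stub-by-stub audit (§3).

LANDED in the tree (importable; same statements, namespace
`Summit.Parity.GeneralizedHardyLittlewood.Theorems.TypeIILiouville.Negative`):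
`Theorems/TypeIILiouville/Negative/TypeIILiouvilleLoadBearing.lean` (p99094: §1, §2(a), §2(b), `χ₄`),
`Theorems/TypeIILiouville/Negative/TypeIILiouvillePretenders.lean` (p103042: §2(c) general form),
`Theorems/TypeIILiouville/Negative/TypeIILiouvilleVariance.lean` (p106305: §2(d)).
This work file stays self-contained (it re-declares the same lemmas under `…Cruxes.TypeIILiouville.Disproof`).

The crux, in operator-norm form (`typeIILiouville_iff`, `Iff.rfl`):
`TypeIILiouville ⟺ ∀ c ≠ 0 ∃ η > 0 ∃ C ∀ 1 ≤ N ≤ M : ‖(λ(mn+c))_{m∈(M,2M], n∈(N,2N]}‖_op ≤ C (√M + √N · M^{1/2-η})`.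
Trivial bound `√(MN)`; random `±1` matrices give `√M + √N`; the rank-one lower bound is `√M`
(§2), so the ratio `‖A‖_op / √(MN)` always lies in `[N^{-1/2}, 1]`.

## Index
1. `TypeIIShape f c` — the crux's inequality for a general weight `f` and shift `c`
   (`TypeIILiouville ↔ ∀ c ≠ 0, TypeIIShape lam c`).
2. LOAD-BEARING / TIGHTNESS / CARICATURE theorems (all sorry-free):
   * (a) `not_typeIIShape_lam_zero`, `typeIILiouville_false_without_shift_ne_zero` — the
     hypothesis `c ≠ 0` is load-bearing: at `c = 0` complete multiplicativity `λ(mn) = λ(m)λ(n)`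
     makes the matrix rank one with norm `√(MN)` (witness `α = β = λ`, `M = N → ∞`).
   * (b) `rankOne_sum`/`rankOne_alpha_sq`/`rankOne_beta_sq`, `not_typeIIShapeStrongN_lam`,
     `not_typeIILiouvilleStrongN` — the diagonal term `N^{-1/2}` is attained in EVERY box
     (witness `β = δ_{N+1}`, `α_m = λ(m(N+1)+c)` gives `|B| = ‖α‖‖β‖√(MN)·N^{-1/2}` exactly), so
     the strengthening with `N^{-(1/2+δ)}`, `δ > 0`, is false for every shift `c`; any proof
     must lose exactly the diagonal `n = n'` of the Cauchy–Schwarz in `DilatedChowlaToTypeII`.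
   * (c) `not_typeIIShape_of_periodic` (corollaries `not_typeIIShape_chi4`,
     `not_typeIIShape_const`, `not_typeIIShape_dirichlet` for every real Dirichlet character) — the crux's shape is FALSE at every shift `c` when `λ` is
     replaced by ANY `q`-periodic weight `f ≢ 0` (on `m ≡ 1`, `n ≡ r-c (mod q)`: `f(mn+c) = f(r)`),
     in particular by any Dirichlet character of any modulus (completely multiplicative,
     mean-zero, `{0,±1}`-valued for real `χ`). Hence no argument using only boundedness, complete
     multiplicativity and mean zero of `λ` can prove the crux: the proof must separate `λ` from
     every periodic function QUANTITATIVELY at scale `M^η` — power non-pretentiousness, the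
     zero-free-strip content made rigorous by line `Sketch` (`TypeIILiouville → quasi-RH`).
3. LINE `Sketch` (lead `prover-line-stmt-Parity-13322-0`; stubs A, B, U2, V, C, D; composition
   kernel-checked): audit in §3 below — every stub survives (paper proofs sketched there, with
   the exponent bookkeeping that makes A and V work); two SHARPNESS remarks for the lead.
   * (d) `dilationVariance_le_of_typeIIShape`, `typeIILiouville_false_of_dilationVariance_large`
     — REFUTATION TEMPLATE: the crux (tested on `β = 1`, `α_m = Σ_n λ(mn+c)`) forces
     `V_c(M,N) = Σ_m (Σ_{n∼N} λ(mn+c))² ≤ C² M N² (N^{-1/2}+M^{-η})²`; any family of boxes with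
     `V ≥ M N^{1+κ}`, `N ≤ M^{o(1)}`, at one shift kills the crux (none is known or expected).
4. WHY THE CRUX RESISTS (near-misses, none formalisable today): §4 below.

Mutations that do NOT break (information for provers): dropping `N ≤ M` (the mirrored statement
is equally consistent with the random model, since `√(MN)·M^{-η} ≥ √N` for `η ≤ 1/2`); dropping
`1 ≤ N` (the `N = 0` box is empty, both sides are `0`); `c < 0` (entries with `mn + c ≤ 0` are
`λ(0) = 0`, finitely many boxes, absorbed by `C` because the ratio is `≤ √N` in any single box);
uniform `η` for all `c` (random model). A finite computation can never refute the crux: for any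
finite set of boxes `C := max √N` works.
-/

namespace Summit.Parity.GeneralizedHardyLittlewood.Cruxes.TypeIILiouville.Disproof

open Finset Filter
open Summit.Parity.GeneralizedHardyLittlewood.Theses.LiouvilleMAD

/-! ## §1 The shape of the crux for a general weight -/

/-- The crux's inequality with a general arithmetic weight `f` in place of `λ` and shift `c`:
`∃ η > 0, C` such that for all `1 ≤ N ≤ M` and all real `α, β`,
`|Σ_{m∼M} Σ_{n∼N} α_m β_n f(mn+c)| ≤ C ‖α‖₂ ‖β‖₂ √(MN) (N^{-1/2} + M^{-η})`. -/
def TypeIIShape (f : ℕ → ℝ) (c : ℤ) : Prop :=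
  ∃ η : ℝ, 0 < η ∧ ∃ C : ℝ, ∀ M N : ℕ, 1 ≤ N → N ≤ M → ∀ α β : ℕ → ℝ,
    |∑ m ∈ Ioc M (2 * M), ∑ n ∈ Ioc N (2 * N), α m * β n * f (Int.toNat ((m : ℤ) * n + c))| ≤
      C * Real.sqrt (∑ m ∈ Ioc M (2 * M), α m ^ 2) * Real.sqrt (∑ n ∈ Ioc N (2 * N), β n ^ 2) *
        Real.sqrt ((M : ℝ) * N) * ((N : ℝ) ^ (-(1 / 2 : ℝ)) + (M : ℝ) ^ (-η))

/-- The Liouville function as a real weight. -/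
def lam (k : ℕ) : ℝ := (ArithmeticFunction.liouville k : ℝ)

/-- The crux is `TypeIIShape lam c` for every `c ≠ 0` (definitional). -/
theorem typeIILiouville_iff : TypeIILiouville ↔ ∀ c : ℤ, c ≠ 0 → TypeIIShape lam c := Iff.rfl

/-- Complete multiplicativity of `λ` (Mathlib `liouville_apply_mul`), as reals. -/
theorem lam_mul (m n : ℕ) : lam (m * n) = lam m * lam n := by
  simp [lam, ArithmeticFunction.liouville_apply_mul]

/-- `λ(k)² = 1` for `k ≠ 0`. -/
theorem lam_mul_self {k : ℕ} (hk : k ≠ 0) : lam k * lam k = 1 := by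
  simp only [lam, ArithmeticFunction.liouville_apply hk, Int.cast_pow, Int.cast_neg, Int.cast_one]
  rw [← pow_add, ← two_mul, pow_mul]
  simp

/-- `λ(k)^2 = 1` for `k ≠ 0`. -/
theorem lam_sq {k : ℕ} (hk : k ≠ 0) : lam k ^ 2 = 1 := by
  rw [sq, lam_mul_self hk]

/-- `C · u(L)^{-a} → 0` along any `u → ∞`: eventually below any `ε > 0`. -/
theorem eventually_const_mul_rpow_neg_lt (C : ℝ) {a ε : ℝ} (ha : 0 < a) (hε : 0 < ε)
    {u : ℕ → ℝ} (hu : Tendsto u atTop atTop) :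
    ∀ᶠ L : ℕ in atTop, C * (u L) ^ (-a) < ε := by
  have h := ((tendsto_rpow_neg_atTop ha).comp hu).const_mul C
  rw [mul_zero] at h
  exact h.eventually (gt_mem_nhds hε)

/-- The dyadic window `(M, 2M]` has `M` elements. -/
theorem card_Ioc_two_mul (M : ℕ) : (Ioc M (2 * M)).card = M := by
  rw [Nat.card_Ioc]; omega

/-! ## §2(a) LOAD-BEARING: the shift `c ≠ 0`

At `c = 0` the matrix `λ(mn) = λ(m)λ(n)` is rank one of operator norm `√(MN)` (no cancellation at
all against `α = β = λ`), so the crux's shape fails: ANY proof of the crux must use `c ≠ 0`. -/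

/-- The crux's shape is false at shift `c = 0`. Witness: `α = β = λ`, `M = N → ∞`. -/
theorem not_typeIIShape_lam_zero : ¬ TypeIIShape lam 0 := by
  rintro ⟨η, hη, C, h⟩
  obtain ⟨M, hM1, hMa, hMb⟩ := ((eventually_ge_atTop 1).and
    ((eventually_const_mul_rpow_neg_lt C (by norm_num : (0 : ℝ) < 1 / 2) one_half_pos
      tendsto_natCast_atTop_atTop).and
    (eventually_const_mul_rpow_neg_lt C hη one_half_pos tendsto_natCast_atTop_atTop))).exists
  have hbox := h M M hM1 le_rfl lam lam
  have hterm : ∀ m ∈ Ioc M (2 * M), ∀ n ∈ Ioc M (2 * M),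
      lam m * lam n * lam (Int.toNat ((m : ℤ) * n + 0)) = 1 := by
    intro m hm n hn
    have hm0 : m ≠ 0 := by rw [mem_Ioc] at hm; omega
    have hn0 : n ≠ 0 := by rw [mem_Ioc] at hn; omega
    rw [add_zero, ← Nat.cast_mul, Int.toNat_natCast, lam_mul,
      show lam m * lam n * (lam m * lam n) = (lam m * lam m) * (lam n * lam n) by ring,
      lam_mul_self hm0, lam_mul_self hn0, mul_one]
  have hsum : ∑ m ∈ Ioc M (2 * M), ∑ n ∈ Ioc M (2 * M),
      lam m * lam n * lam (Int.toNat ((m : ℤ) * n + 0)) = (M : ℝ) * M := by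
    rw [sum_congr rfl fun m hm => sum_congr rfl fun n hn => hterm m hm n hn]
    simp only [sum_const, card_Ioc_two_mul, nsmul_eq_mul, mul_one]
  have hsq : ∑ m ∈ Ioc M (2 * M), lam m ^ 2 = (M : ℝ) := by
    rw [sum_congr rfl fun m hm => lam_sq (by rw [mem_Ioc] at hm; omega)]
    simp only [sum_const, card_Ioc_two_mul, nsmul_eq_mul, mul_one]
  rw [hsum, hsq] at hbox
  have hMpos : (0 : ℝ) < M := by exact_mod_cast hM1
  have h1 : Real.sqrt (M : ℝ) * Real.sqrt M = M := Real.mul_self_sqrt hMpos.le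
  have h2 : Real.sqrt ((M : ℝ) * M) = M := Real.sqrt_mul_self hMpos.le
  have hrhs : C * Real.sqrt (M : ℝ) * Real.sqrt M * Real.sqrt ((M : ℝ) * M) *
      ((M : ℝ) ^ (-(1 / 2 : ℝ)) + (M : ℝ) ^ (-η)) =
      (C * (M : ℝ) ^ (-(1 / 2 : ℝ)) + C * (M : ℝ) ^ (-η)) * ((M : ℝ) * M) := by
    rw [show C * Real.sqrt (M : ℝ) * Real.sqrt M = C * (Real.sqrt M * Real.sqrt M) by ring, h1, h2]
    ring
  rw [hrhs, abs_of_nonneg (by positivity)] at hbox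
  have hMM : (0 : ℝ) < M * M := by positivity
  nlinarith

/-- The crux with its hypothesis `c ≠ 0` DROPPED. -/
def TypeIILiouvilleWithoutShiftNeZero : Prop := ∀ c : ℤ, TypeIIShape lam c

/-- LOAD-BEARING (a): the crux without `c ≠ 0` is false (at `c = 0`). -/
theorem typeIILiouville_false_without_shift_ne_zero : ¬ TypeIILiouvilleWithoutShiftNeZero :=
  fun h => not_typeIIShape_lam_zero (h 0)

/-! ## §2(b) TIGHTNESS: the diagonal term `N^{-1/2}` is attained in every box

Rank-one witness: `β = δ_{N+1}`, `α_m = λ(m(N+1)+c)`. Then `B = M = ‖α‖² `, `‖β‖ = 1`, so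
`|B| / (‖α‖‖β‖√(MN)) = N^{-1/2}` exactly. Consequently the strengthening of the crux in which
`N^{-1/2}` is replaced by `N^{-(1/2+δ)}` (`δ > 0`) is false for every shift. -/

/-- In the box `m ∈ (M,2M]` with `-c ≤ M`, the argument `m(N+1) + c` is a positive integer. -/
theorem rankOne_pos (c : ℤ) (M N : ℕ) (hc : -c ≤ (M : ℤ)) :
    ∀ m ∈ Ioc M (2 * M), Int.toNat ((m : ℤ) * ((N + 1 : ℕ) : ℤ) + c) ≠ 0 := by
  intro m hm
  rw [mem_Ioc] at hm
  have h1 : (M : ℤ) + 1 ≤ m := by exact_mod_cast hm.1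
  have h2 : (2 : ℤ) ≤ ((N + 1 : ℕ) : ℤ) → ((M : ℤ) + 1) * 2 ≤ (m : ℤ) * ((N + 1 : ℕ) : ℤ) :=
    fun h2 => mul_le_mul h1 h2 (by norm_num) (by positivity)
  have h3 : (1 : ℤ) ≤ ((N + 1 : ℕ) : ℤ) → ((M : ℤ) + 1) * 1 ≤ (m : ℤ) * ((N + 1 : ℕ) : ℤ) :=
    fun h3 => mul_le_mul h1 h3 (by norm_num) (by positivity)
  have h4 : (1 : ℤ) ≤ ((N + 1 : ℕ) : ℤ) := by push_cast; omega
  have h5 := h3 h4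
  generalize (m : ℤ) * ((N + 1 : ℕ) : ℤ) = k at h5 ⊢
  omega

/-- Rank-one witness: the bilinear form equals `M` (every surviving term is `λ(k)² = 1`). -/
theorem rankOne_sum (c : ℤ) (M N : ℕ) (hN : 1 ≤ N) (hc : -c ≤ (M : ℤ)) :
    ∑ m ∈ Ioc M (2 * M), ∑ n ∈ Ioc N (2 * N),
      lam (Int.toNat ((m : ℤ) * ((N + 1 : ℕ) : ℤ) + c)) * (if n = N + 1 then (1 : ℝ) else 0) *
        lam (Int.toNat ((m : ℤ) * n + c)) = M := by
  have hmem : N + 1 ∈ Ioc N (2 * N) := by rw [mem_Ioc]; omega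
  calc ∑ m ∈ Ioc M (2 * M), ∑ n ∈ Ioc N (2 * N),
      lam (Int.toNat ((m : ℤ) * ((N + 1 : ℕ) : ℤ) + c)) * (if n = N + 1 then (1 : ℝ) else 0) *
        lam (Int.toNat ((m : ℤ) * n + c))
      = ∑ m ∈ Ioc M (2 * M), (1 : ℝ) := by
        refine sum_congr rfl fun m hm => ?_
        rw [sum_eq_single_of_mem (N + 1) hmem (fun n _ hne => by simp [hne])]
        rw [if_pos rfl, mul_one, lam_mul_self (rankOne_pos c M N hc m hm)]
    _ = M := by simp only [sum_const, card_Ioc_two_mul, nsmul_eq_mul, mul_one]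

/-- Rank-one witness: `‖α‖₂² = M`. -/
theorem rankOne_alpha_sq (c : ℤ) (M N : ℕ) (hc : -c ≤ (M : ℤ)) :
    ∑ m ∈ Ioc M (2 * M), lam (Int.toNat ((m : ℤ) * ((N + 1 : ℕ) : ℤ) + c)) ^ 2 = M := by
  rw [sum_congr rfl fun m hm => lam_sq (rankOne_pos c M N hc m hm)]
  simp only [sum_const, card_Ioc_two_mul, nsmul_eq_mul, mul_one]

/-- Rank-one witness: `‖β‖₂² = 1` (`β = δ_{N+1}`, and `N+1 ∈ (N,2N]` for `N ≥ 1`). -/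
theorem rankOne_beta_sq (N : ℕ) (hN : 1 ≤ N) :
    ∑ n ∈ Ioc N (2 * N), (if n = N + 1 then (1 : ℝ) else 0) ^ 2 = 1 := by
  have hmem : N + 1 ∈ Ioc N (2 * N) := by rw [mem_Ioc]; omega
  rw [sum_eq_single_of_mem (N + 1) hmem (fun n _ hne => by simp [hne])]
  simp

/-- TIGHTNESS (b): in every box the ratio `|B| / (‖α‖₂‖β‖₂√(MN))` reaches `N^{-1/2}`
(here for `-c ≤ M`, which covers every `c ≥ 0` and all large boxes). -/
theorem rankOne_ratio (c : ℤ) (M N : ℕ) (hN : 1 ≤ N) (hc : -c ≤ (M : ℤ)) :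
    |∑ m ∈ Ioc M (2 * M), ∑ n ∈ Ioc N (2 * N),
      lam (Int.toNat ((m : ℤ) * ((N + 1 : ℕ) : ℤ) + c)) * (if n = N + 1 then (1 : ℝ) else 0) *
        lam (Int.toNat ((m : ℤ) * n + c))| = M ∧
    Real.sqrt (∑ m ∈ Ioc M (2 * M), lam (Int.toNat ((m : ℤ) * ((N + 1 : ℕ) : ℤ) + c)) ^ 2) *
      Real.sqrt (∑ n ∈ Ioc N (2 * N), (if n = N + 1 then (1 : ℝ) else 0) ^ 2) *
      Real.sqrt ((M : ℝ) * N) * (N : ℝ) ^ (-(1 / 2 : ℝ)) = M := by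
  refine ⟨by rw [rankOne_sum c M N hN hc]; exact abs_of_nonneg (Nat.cast_nonneg M), ?_⟩
  rw [rankOne_alpha_sq c M N hc, rankOne_beta_sq N hN, Real.sqrt_one, mul_one]
  have hMpos : (0 : ℝ) ≤ M := Nat.cast_nonneg M
  have hNpos : (0 : ℝ) < N := by exact_mod_cast hN
  rw [Real.sqrt_mul hMpos, show Real.sqrt (M : ℝ) * (Real.sqrt M * Real.sqrt N) * (N : ℝ) ^ (-(1 / 2 : ℝ))
    = (Real.sqrt (M : ℝ) * Real.sqrt M) * (Real.sqrt N * (N : ℝ) ^ (-(1 / 2 : ℝ))) by ring,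
    Real.mul_self_sqrt hMpos, Real.sqrt_eq_rpow, ← Real.rpow_add hNpos]
  norm_num

/-- STRENGTHENING (S1) of the crux's shape: diagonal term `N^{-(1/2+δ)}` with `δ > 0`. -/
def TypeIIShapeStrongN (f : ℕ → ℝ) (c : ℤ) : Prop :=
  ∃ η : ℝ, 0 < η ∧ ∃ δ : ℝ, 0 < δ ∧ ∃ C : ℝ, ∀ M N : ℕ, 1 ≤ N → N ≤ M → ∀ α β : ℕ → ℝ,
    |∑ m ∈ Ioc M (2 * M), ∑ n ∈ Ioc N (2 * N), α m * β n * f (Int.toNat ((m : ℤ) * n + c))| ≤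
      C * Real.sqrt (∑ m ∈ Ioc M (2 * M), α m ^ 2) * Real.sqrt (∑ n ∈ Ioc N (2 * N), β n ^ 2) *
        Real.sqrt ((M : ℝ) * N) * ((N : ℝ) ^ (-(1 / 2 + δ : ℝ)) + (M : ℝ) ^ (-η))

/-- (S1) is false for `λ` and EVERY shift `c` (rank-one witness; `N → ∞` then `M → ∞`). -/
theorem not_typeIIShapeStrongN_lam (c : ℤ) : ¬ TypeIIShapeStrongN lam c := by
  rintro ⟨η, hη, δ, hδ, C, h⟩
  obtain ⟨N, hN1, hNa⟩ := ((eventually_ge_atTop 1).and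
    (eventually_const_mul_rpow_neg_lt C hδ one_half_pos tendsto_natCast_atTop_atTop)).exists
  obtain ⟨M, hMN, hMc, hMb⟩ := ((eventually_ge_atTop N).and ((eventually_ge_atTop (Int.toNat (-c))).and
    (eventually_const_mul_rpow_neg_lt (C * Real.sqrt N) hη one_half_pos
      tendsto_natCast_atTop_atTop))).exists
  have hc : -c ≤ (M : ℤ) := by have := Int.self_le_toNat (-c); omega
  have hbox := h M N hN1 hMN (fun m => lam (Int.toNat ((m : ℤ) * ((N + 1 : ℕ) : ℤ) + c)))
    (fun n => if n = N + 1 then (1 : ℝ) else 0)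
  beta_reduce at hbox
  rw [rankOne_sum c M N hN1 hc, rankOne_alpha_sq c M N hc, rankOne_beta_sq N hN1,
    Real.sqrt_one, mul_one] at hbox
  have hMpos : (0 : ℝ) < M := by exact_mod_cast (hN1.trans hMN)
  have hNpos : (0 : ℝ) < N := by exact_mod_cast hN1
  have hsN : Real.sqrt (N : ℝ) * (N : ℝ) ^ (-(1 / 2 + δ : ℝ)) = (N : ℝ) ^ (-δ) := by
    rw [Real.sqrt_eq_rpow, ← Real.rpow_add hNpos]; congr 1; ring
  have hrhs : C * Real.sqrt (M : ℝ) * Real.sqrt ((M : ℝ) * N) *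
      ((N : ℝ) ^ (-(1 / 2 + δ : ℝ)) + (M : ℝ) ^ (-η)) =
      (M : ℝ) * (C * (N : ℝ) ^ (-δ) + C * Real.sqrt N * (M : ℝ) ^ (-η)) := by
    rw [Real.sqrt_mul hMpos.le, ← hsN]
    have := Real.mul_self_sqrt hMpos.le
    calc C * Real.sqrt (M : ℝ) * (Real.sqrt M * Real.sqrt N) *
        ((N : ℝ) ^ (-(1 / 2 + δ : ℝ)) + (M : ℝ) ^ (-η))
        = (Real.sqrt (M : ℝ) * Real.sqrt M) * (C * (Real.sqrt N * (N : ℝ) ^ (-(1 / 2 + δ : ℝ))) +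
            C * Real.sqrt N * (M : ℝ) ^ (-η)) := by ring
      _ = _ := by rw [this]
  rw [hrhs, abs_of_nonneg hMpos.le] at hbox
  nlinarith

/-- The crux with the diagonal term improved (for `c ≠ 0`). -/
def TypeIILiouvilleStrongN : Prop := ∀ c : ℤ, c ≠ 0 → TypeIIShapeStrongN lam c

/-- TIGHTNESS (b), packaged: the diagonal term of the crux cannot be improved. -/
theorem not_typeIILiouvilleStrongN : ¬ TypeIILiouvilleStrongN :=
  fun h => not_typeIIShapeStrongN_lam 1 (h 1 one_ne_zero)

/-! ## §2(c) CARICATURE: the shape fails for EVERY nonzero periodic weight, at every shift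

If `f` is `q`-periodic and `f r ≠ 0`, then on `m ≡ 1`, `n ≡ r - c (mod q)` one has `f(mn+c) = f(r)`:
a sub-box of density `q^{-2}` on which the matrix is constant, so the shape inequality fails
(`M = qM'`, `N = qN' → ∞`). In particular it fails for every Dirichlet character of any modulus in
place of `λ` (the Landau–Siegel caricature `λ ≈ χ (mod q)` in Lean form: `not_typeIIShape_chi4`),
and for the constant weight (the main-term ghost, `not_typeIIShape_const`). So boundedness,
complete multiplicativity and mean zero of the weight cannot suffice for the crux: a proof must
separate `λ` from all its periodic shadows with a POWER saving at scale `M^η`. -/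

/-- Indicator of the residue class `a mod q`. -/
def indQ (q a : ℕ) (m : ℕ) : ℝ := if m % q = a then 1 else 0

/-- `indQ q a` is `{0,1}`-valued. -/
theorem indQ_sq (q a m : ℕ) : indQ q a m ^ 2 = indQ q a m := by
  unfold indQ; split <;> norm_num

/-- The representative of `a mod q` in `[1, q]`. -/
def rep (q a : ℕ) : ℕ := if a = 0 then q else a

/-- `1 ≤ rep q a` for `q ≥ 1`. -/
theorem rep_pos {q : ℕ} (a : ℕ) (hq : 1 ≤ q) : 1 ≤ rep q a := by
  unfold rep; split <;> omega

/-- `rep q a ≤ q` for `a < q`. -/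
theorem rep_le {q a : ℕ} (haq : a < q) : rep q a ≤ q := by
  unfold rep; split <;> omega

/-- `rep q a ≡ a (mod q)`. -/
theorem rep_mod {q a : ℕ} (haq : a < q) : rep q a % q = a := by
  unfold rep; split
  · subst_vars; exact Nat.mod_self q
  · exact Nat.mod_eq_of_lt haq

/-- At least `L` elements of `(qL, 2qL]` lie in any residue class `a mod q` (`a < q`). -/
theorem le_card_filter_mod (q L a : ℕ) (hq : 1 ≤ q) (haq : a < q) :
    L ≤ ((Ioc (q * L) (2 * (q * L))).filter (fun m => m % q = a)).card := by
  have hinj : Set.InjOn (fun j => q * (L + j) + rep q a) (range L : Set ℕ) := by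
    intro x _ y _ hxy
    simp only at hxy
    have h1 : q * (L + x) = q * (L + y) := Nat.add_right_cancel hxy
    have h2 := Nat.eq_of_mul_eq_mul_left (by omega : 0 < q) h1
    omega
  calc L = (range L).card := (card_range L).symm
    _ = ((range L).image (fun j => q * (L + j) + rep q a)).card := (card_image_of_injOn hinj).symm
    _ ≤ _ := by
      apply card_le_card
      intro m hm
      simp only [mem_image, mem_range] at hm
      obtain ⟨j, hj, rfl⟩ := hm
      simp only [mem_filter, mem_Ioc]
      refine ⟨⟨?_, ?_⟩, ?_⟩
      · calc q * L ≤ q * (L + j) := Nat.mul_le_mul_left q (by omega)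
          _ < q * (L + j) + rep q a := Nat.lt_add_of_pos_right (rep_pos a hq)
      · calc q * (L + j) + rep q a ≤ q * (L + j) + q := Nat.add_le_add_left (rep_le haq) _
          _ = q * (L + j + 1) := by ring
          _ ≤ q * (2 * L) := Nat.mul_le_mul_left q (by omega)
          _ = 2 * (q * L) := by ring
      · rw [Nat.mul_add_mod_self_left, rep_mod haq]

/-- CARICATURE, general form: the crux's shape is false at every shift for EVERY `q`-periodic weight
that is not identically zero. -/
theorem not_typeIIShape_of_periodic {f : ℕ → ℝ} {q : ℕ} (hq : 1 ≤ q)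
    (hper : ∀ k, f (k + q) = f k) {r : ℕ} (hr : f r ≠ 0) (c : ℤ) : ¬ TypeIIShape f c := by
  rintro ⟨η, hη, C, h⟩
  have hper' : ∀ t k, f (k + q * t) = f k := by
    intro t
    induction t with
    | zero => intro k; simp
    | succ t ih => intro k; rw [Nat.mul_succ, ← add_assoc, hper, ih]
  -- residues: `m ≡ 1`, `n ≡ b :≡ r - c (mod q)`, so that `mn + c ≡ r (mod q)`
  set b : ℕ := Int.toNat (((r : ℤ) - c) % q) with hb_def
  have hq0 : (0 : ℤ) < q := by exact_mod_cast hq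
  have hbq : b < q := by have := Int.emod_lt_of_pos ((r : ℤ) - c) hq0; omega
  have hb : (b : ℤ) = ((r : ℤ) - c) % q := by
    have := Int.emod_nonneg ((r : ℤ) - c) hq0.ne'; omega
  have h1q : 1 % q < q := Nat.mod_lt 1 (by omega)
  -- thresholds
  have hvpos : 0 < |f r| := abs_pos.mpr hr
  have hqR : (0 : ℝ) < q := by exact_mod_cast hq
  have hε : 0 < |f r| / (2 * q) := by positivity
  have hu : Tendsto (fun L : ℕ => ((q * L : ℕ) : ℝ)) atTop atTop :=
    tendsto_natCast_atTop_atTop.comp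
      (tendsto_atTop_mono (fun L => show id L ≤ q * L by
        dsimp only [id]; exact Nat.le_mul_of_pos_left L (by omega)) tendsto_id)
  obtain ⟨N', hN'1, hN'a⟩ := ((eventually_ge_atTop 1).and
    (eventually_const_mul_rpow_neg_lt C (by norm_num : (0 : ℝ) < 1 / 2) hε hu)).exists
  obtain ⟨M', hM'N, hM'c, hM'b⟩ := ((eventually_ge_atTop N').and
    ((eventually_ge_atTop (r + Int.toNat (-c))).and
    (eventually_const_mul_rpow_neg_lt C hη hε hu))).exists
  replace hN'a : C * ((q * N' : ℕ) : ℝ) ^ (-(1 / 2 : ℝ)) < |f r| / (2 * q) := hN'a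
  replace hM'b : C * ((q * M' : ℕ) : ℝ) ^ (-η) < |f r| / (2 * q) := hM'b
  have hqN1 : 1 ≤ q * N' := Nat.succ_le_of_lt (Nat.mul_pos (by omega) (by omega))
  have hbox := h (q * M') (q * N') hqN1 (Nat.mul_le_mul_left q hM'N) (indQ q (1 % q)) (indQ q b)
  -- every surviving term is `f r`
  have hterm : ∀ m ∈ Ioc (q * M') (2 * (q * M')), ∀ n ∈ Ioc (q * N') (2 * (q * N')),
      indQ q (1 % q) m * indQ q b n * f (Int.toNat ((m : ℤ) * n + c)) =
        indQ q (1 % q) m * indQ q b n * f r := by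
    intro m hm n hn
    rw [mem_Ioc] at hm hn
    by_cases hma : m % q = 1 % q
    · by_cases hnb : n % q = b
      · -- `mn ≡ b (mod q)` in `ℕ`
        have hk : (m * n) % q = b := by
          rw [Nat.mul_mod, hma, hnb, Nat.mod_mul_mod, one_mul, Nat.mod_eq_of_lt hbq]
        -- size: `mn + c ≥ m - |c| > r`
        have hmn : (m : ℤ) ≤ (m : ℤ) * n :=
          le_mul_of_one_le_right (by positivity) (by exact_mod_cast (show 1 ≤ n by nlinarith))
        have hm1 : (q : ℤ) * M' + 1 ≤ m := by exact_mod_cast hm.1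
        have hM'1 : (M' : ℤ) ≤ (q : ℤ) * M' := by exact_mod_cast Nat.le_mul_of_pos_left M' (by omega)
        have hzr : (r : ℤ) ≤ (m : ℤ) * n + c := by
          have := Int.self_le_toNat (-c); omega
        -- divisibility: `mn + c - r = q · w`
        have hd : ((m * n : ℕ) : ℤ) = b + q * ((m * n / q : ℕ) : ℤ) := by
          have := Nat.mod_add_div (m * n) q
          rw [hk] at this
          exact_mod_cast this.symm
        have he : (r : ℤ) - c = b + q * (((r : ℤ) - c) / q) := by
          rw [hb]; exact (Int.emod_add_mul_ediv _ _).symm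
        have hw : (m : ℤ) * n + c - r = q * (((m * n / q : ℕ) : ℤ) - ((r : ℤ) - c) / q) := by
          have hd' : (m : ℤ) * n = b + q * ((m * n / q : ℕ) : ℤ) := by exact_mod_cast hd
          linear_combination hd' - he
        set w : ℤ := ((m * n / q : ℕ) : ℤ) - ((r : ℤ) - c) / q with hw_def
        have hw0 : 0 ≤ w := nonneg_of_mul_nonneg_right (by rw [← hw]; linarith) hq0
        -- so `toNat (mn + c) = r + q * toNat w`
        have hK : Int.toNat ((m : ℤ) * n + c) = r + q * Int.toNat w := by
          have h0 : 0 ≤ (m : ℤ) * n + c := by linarith [hzr]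
          have h1 : ((Int.toNat ((m : ℤ) * n + c) : ℕ) : ℤ) = ((r + q * Int.toNat w : ℕ) : ℤ) := by
            rw [Int.toNat_of_nonneg h0]; push_cast; rw [Int.toNat_of_nonneg hw0]; linarith
          exact_mod_cast h1
        rw [hK, hper' (Int.toNat w) r]
      · simp [indQ, hnb]
    · simp [indQ, hma]
  have hsum : ∑ m ∈ Ioc (q * M') (2 * (q * M')), ∑ n ∈ Ioc (q * N') (2 * (q * N')),
      indQ q (1 % q) m * indQ q b n * f (Int.toNat ((m : ℤ) * n + c)) =
      (((Ioc (q * M') (2 * (q * M'))).filter (fun m => m % q = 1 % q)).card : ℝ) *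
      (((Ioc (q * N') (2 * (q * N'))).filter (fun n => n % q = b)).card : ℝ) * f r := by
    rw [sum_congr rfl fun m hm => sum_congr rfl fun n hn => hterm m hm n hn]
    simp_rw [← sum_mul]
    rw [← sum_mul_sum]
    simp only [indQ, sum_boole]
  have hsqA : ∑ m ∈ Ioc (q * M') (2 * (q * M')), indQ q (1 % q) m ^ 2 =
      (((Ioc (q * M') (2 * (q * M'))).filter (fun m => m % q = 1 % q)).card : ℝ) := by
    simp only [indQ_sq]; simp only [indQ, sum_boole]
  have hsqB : ∑ n ∈ Ioc (q * N') (2 * (q * N')), indQ q b n ^ 2 =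
      (((Ioc (q * N') (2 * (q * N'))).filter (fun n => n % q = b)).card : ℝ) := by
    simp only [indQ_sq]; simp only [indQ, sum_boole]
  rw [hsum, hsqA, hsqB] at hbox
  set x : ℝ := (((Ioc (q * M') (2 * (q * M'))).filter (fun m => m % q = 1 % q)).card : ℝ) with hx
  set y : ℝ := (((Ioc (q * N') (2 * (q * N'))).filter (fun n => n % q = b)).card : ℝ) with hy
  have hxM : (M' : ℝ) ≤ x := by rw [hx]; exact_mod_cast le_card_filter_mod q M' (1 % q) hq h1q
  have hyN : (N' : ℝ) ≤ y := by rw [hy]; exact_mod_cast le_card_filter_mod q N' b hq hbq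
  have hM'pos : (0 : ℝ) < M' := by exact_mod_cast (hN'1.trans hM'N)
  have hN'pos : (0 : ℝ) < N' := by exact_mod_cast hN'1
  have hxpos : 0 < x := hM'pos.trans_le hxM
  have hypos : 0 < y := hN'pos.trans_le hyN
  have hP : Real.sqrt (((q * M' : ℕ) : ℝ) * ((q * N' : ℕ) : ℝ)) = q * (Real.sqrt M' * Real.sqrt N') := by
    push_cast
    rw [show (q : ℝ) * M' * (q * N') = (q * q) * ((M' : ℝ) * N') by ring,
      Real.sqrt_mul (by positivity), Real.sqrt_mul_self hqR.le, Real.sqrt_mul hM'pos.le]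
  have hst : Real.sqrt M' * Real.sqrt N' ≤ Real.sqrt x * Real.sqrt y :=
    mul_le_mul (Real.sqrt_le_sqrt hxM) (Real.sqrt_le_sqrt hyN) (Real.sqrt_nonneg _)
      (Real.sqrt_nonneg _)
  have htpos : 0 < Real.sqrt M' * Real.sqrt N' :=
    mul_pos (Real.sqrt_pos.mpr hM'pos) (Real.sqrt_pos.mpr hN'pos)
  have hspos : 0 < Real.sqrt x * Real.sqrt y := htpos.trans_le hst
  rw [hP, abs_mul, abs_of_nonneg (by positivity : (0 : ℝ) ≤ x * y)] at hbox
  have hxy : x * y = (Real.sqrt x * Real.sqrt y) * (Real.sqrt x * Real.sqrt y) := by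
    rw [show Real.sqrt x * Real.sqrt y * (Real.sqrt x * Real.sqrt y) =
      (Real.sqrt x * Real.sqrt x) * (Real.sqrt y * Real.sqrt y) by ring,
      Real.mul_self_sqrt hxpos.le, Real.mul_self_sqrt hypos.le]
  rw [hxy] at hbox
  -- `|f r| · s ≤ C q t X`
  have hs_le : Real.sqrt x * Real.sqrt y * |f r| ≤ C * (q * (Real.sqrt M' * Real.sqrt N')) *
      ((((q * N' : ℕ) : ℝ)) ^ (-(1 / 2 : ℝ)) + (((q * M' : ℕ) : ℝ)) ^ (-η)) := by
    refine le_of_mul_le_mul_left ?_ hspos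
    calc Real.sqrt x * Real.sqrt y * (Real.sqrt x * Real.sqrt y * |f r|)
        = Real.sqrt x * Real.sqrt y * (Real.sqrt x * Real.sqrt y) * |f r| := by ring
      _ ≤ C * Real.sqrt x * Real.sqrt y * (q * (Real.sqrt M' * Real.sqrt N')) *
          ((((q * N' : ℕ) : ℝ)) ^ (-(1 / 2 : ℝ)) + (((q * M' : ℕ) : ℝ)) ^ (-η)) := hbox
      _ = Real.sqrt x * Real.sqrt y * (C * (q * (Real.sqrt M' * Real.sqrt N')) *
          ((((q * N' : ℕ) : ℝ)) ^ (-(1 / 2 : ℝ)) + (((q * M' : ℕ) : ℝ)) ^ (-η))) := by ring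
  have hCX : C * (((q * N' : ℕ) : ℝ)) ^ (-(1 / 2 : ℝ)) + C * (((q * M' : ℕ) : ℝ)) ^ (-η) <
      |f r| / q := by
    have : |f r| / (2 * q) + |f r| / (2 * q) = |f r| / q := by field_simp; ring
    linarith
  have hkey : C * (q * (Real.sqrt M' * Real.sqrt N')) *
      ((((q * N' : ℕ) : ℝ)) ^ (-(1 / 2 : ℝ)) + (((q * M' : ℕ) : ℝ)) ^ (-η)) <
      (Real.sqrt M' * Real.sqrt N') * |f r| := by
    have := mul_lt_mul_of_pos_left hCX (mul_pos hqR htpos)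
    calc C * (q * (Real.sqrt M' * Real.sqrt N')) *
        ((((q * N' : ℕ) : ℝ)) ^ (-(1 / 2 : ℝ)) + (((q * M' : ℕ) : ℝ)) ^ (-η))
        = (q * (Real.sqrt M' * Real.sqrt N')) * (C * (((q * N' : ℕ) : ℝ)) ^ (-(1 / 2 : ℝ)) +
            C * (((q * M' : ℕ) : ℝ)) ^ (-η)) := by ring
      _ < (q * (Real.sqrt M' * Real.sqrt N')) * (|f r| / q) := this
      _ = (Real.sqrt M' * Real.sqrt N') * |f r| := by field_simp
  nlinarith

/-- The primitive Dirichlet character mod 4, as a real weight. -/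
def chi4 (k : ℕ) : ℝ := if k % 4 = 1 then 1 else if k % 4 = 3 then -1 else 0

/-- Corollary: the shape fails for `χ₄` at every shift. -/
theorem not_typeIIShape_chi4 (c : ℤ) : ¬ TypeIIShape chi4 c :=
  not_typeIIShape_of_periodic (q := 4) (by norm_num) (fun k => by simp [chi4, Nat.add_mod_right])
    (r := 1) (by norm_num [chi4]) c

/-- Corollary: the shape fails for every constant nonzero weight (e.g. `f ≡ 1`, the main-term ghost). -/
theorem not_typeIIShape_const {v : ℝ} (hv : v ≠ 0) (c : ℤ) : ¬ TypeIIShape (fun _ => v) c :=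
  not_typeIIShape_of_periodic (q := 1) le_rfl (fun _ => rfl) (r := 0) hv c

/-- Corollary: the shape fails for every real Dirichlet character of any modulus `q ≥ 1` in place of
`λ` (the Landau–Siegel caricature `λ ≈ χ (mod q)` — e.g. a quadratic `χ` with an exceptional zero),
at every shift. -/
theorem not_typeIIShape_dirichlet {q : ℕ} [NeZero q] (χ : DirichletCharacter ℝ q) (c : ℤ) :
    ¬ TypeIIShape (fun k => χ (k : ZMod q)) c :=
  not_typeIIShape_of_periodic (q := q) (Nat.one_le_iff_ne_zero.mpr (NeZero.ne q))
    (fun k => by simp) (r := 1) (by simp) c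

/-! ## §2(d) REFUTATION TEMPLATE: the crux bounds the dilation variance (test `β = 1`)

Testing the crux against `β = 1`, `α_m = Σ_{n∼N} λ(mn+c)` (the adversarial row sums) gives
`V_c(M,N) := Σ_{m∼M} (Σ_{n∼N} λ(mn+c))² ≤ C² M N² (N^{-1/2} + M^{-η})²`, i.e. square-root
cancellation in MEAN SQUARE over `m` of `λ` along the dilation progressions `{mn+c}_{n∼N}` as soon as
`N ≤ M^{2η}` (random value `V ≍ MN`; numerics IdeatorMemo1 §2: `V/(MN) ∈ [0.94, 1.07]` at
`M = 2048`; this seat's kit j017957: `V/(MN) ∈ [0.978, 1.016]` for `M ≤ 2¹⁷`, `N ≤ 362`,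
`c ∈ {1,-1,2}`). So a refutation of the crux would follow from ANY family of boxes with
`V_c(M,N) ≥ M N^{1+κ}`, `N ≤ M^{o(1)}` — the cheapest Ω-target
(`typeIILiouville_false_of_dilationVariance_large`). -/

/-- The `m`-averaged variance of `λ` along the dilation progressions `{mn+c : n ∈ (N,2N]}`. -/
def dilationVariance (c : ℤ) (M N : ℕ) : ℝ :=
  ∑ m ∈ Ioc M (2 * M), (∑ n ∈ Ioc N (2 * N), lam (Int.toNat ((m : ℤ) * n + c))) ^ 2

/-- The crux's shape at shift `c` bounds the dilation variance:
`V_c(M,N) ≤ C² M N² (N^{-1/2} + M^{-η})²` for all `1 ≤ N ≤ M`. -/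
theorem dilationVariance_le_of_typeIIShape {c : ℤ} (h : TypeIIShape lam c) :
    ∃ η : ℝ, 0 < η ∧ ∃ C : ℝ, ∀ M N : ℕ, 1 ≤ N → N ≤ M →
      dilationVariance c M N ≤
        C ^ 2 * M * N ^ 2 * ((N : ℝ) ^ (-(1 / 2 : ℝ)) + (M : ℝ) ^ (-η)) ^ 2 := by
  obtain ⟨η, hη, C, h⟩ := h
  refine ⟨η, hη, C, fun M N hN hNM => ?_⟩
  have hbox := h M N hN hNM (fun m => ∑ n ∈ Ioc N (2 * N), lam (Int.toNat ((m : ℤ) * n + c)))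
    (fun _ => 1)
  beta_reduce at hbox
  have hL : ∑ m ∈ Ioc M (2 * M), ∑ n ∈ Ioc N (2 * N),
      (∑ n ∈ Ioc N (2 * N), lam (Int.toNat ((m : ℤ) * n + c))) * 1 *
        lam (Int.toNat ((m : ℤ) * n + c)) = dilationVariance c M N := by
    unfold dilationVariance
    refine sum_congr rfl fun m _ => ?_
    rw [sq, mul_sum]
    exact sum_congr rfl fun n _ => by ring
  have hA : ∑ m ∈ Ioc M (2 * M), (∑ n ∈ Ioc N (2 * N), lam (Int.toNat ((m : ℤ) * n + c))) ^ 2 =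
      dilationVariance c M N := rfl
  have hβ : ∑ n ∈ Ioc N (2 * N), (1 : ℝ) ^ 2 = N := by
    simp only [one_pow, sum_const, card_Ioc_two_mul, nsmul_eq_mul, mul_one]
  rw [hL, hA, hβ] at hbox
  set V := dilationVariance c M N with hVdef
  set X := (N : ℝ) ^ (-(1 / 2 : ℝ)) + (M : ℝ) ^ (-η) with hXdef
  have hV0 : 0 ≤ V := sum_nonneg fun _ _ => sq_nonneg _
  rw [abs_of_nonneg hV0] at hbox
  rcases hV0.eq_or_lt with hV | hV
  · rw [← hV]; positivity
  · have hs : 0 < Real.sqrt V := Real.sqrt_pos.mpr hV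
    have hle : Real.sqrt V ≤ C * (Real.sqrt N * Real.sqrt ((M : ℝ) * N) * X) := by
      refine le_of_mul_le_mul_left ?_ hs
      calc Real.sqrt V * Real.sqrt V = V := Real.mul_self_sqrt hV0
        _ ≤ C * Real.sqrt V * Real.sqrt N * Real.sqrt ((M : ℝ) * N) * X := hbox
        _ = Real.sqrt V * (C * (Real.sqrt N * Real.sqrt ((M : ℝ) * N) * X)) := by ring
    calc V = Real.sqrt V ^ 2 := (Real.sq_sqrt hV0).symm
      _ ≤ (C * (Real.sqrt N * Real.sqrt ((M : ℝ) * N) * X)) ^ 2 := pow_le_pow_left₀ hs.le hle 2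
      _ = C ^ 2 * M * N ^ 2 * X ^ 2 := by
          rw [mul_pow, mul_pow, mul_pow, Real.sq_sqrt (by positivity), Real.sq_sqrt (by positivity)]
          ring

/-- REFUTATION TEMPLATE: a power failure of square-root cancellation in the dilation variance at
ONE shift `c ≠ 0` — boxes `1 ≤ N ≤ M` with `V_c(M,N) > C² M N² (N^{-1/2} + M^{-η})²` for every
`η > 0` and `C` — refutes the crux. -/
theorem typeIILiouville_false_of_dilationVariance_large {c : ℤ} (hc : c ≠ 0)
    (hV : ∀ η : ℝ, 0 < η → ∀ C : ℝ, ∃ M N : ℕ, 1 ≤ N ∧ N ≤ M ∧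
      C ^ 2 * M * N ^ 2 * ((N : ℝ) ^ (-(1 / 2 : ℝ)) + (M : ℝ) ^ (-η)) ^ 2 < dilationVariance c M N) :
    ¬ TypeIILiouville := by
  intro h
  obtain ⟨η, hη, C, hb⟩ := dilationVariance_le_of_typeIIShape (h c hc)
  obtain ⟨M, N, hN, hNM, hlt⟩ := hV η hη C
  exact absurd hlt (not_lt.mpr (hb M N hN hNM))

/-! ## §3 LINE `Sketch` (negative line `TypeIILiouville → ∃ δ > 0, QuasiRiemannHypothesis (1-δ)`):
## stub audit — ALL STUBS SURVIVE (cycle 1)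

Read: `Cruxes/TypeIILiouville/Lines/Sketch.lean` (lead prover-line-stmt-Parity-13322-0), the
composition `quasiRH_of_typeIILiouville := stub_C (stub_A h) (stub_V stub_B stub_U2)`,
`stub_D`, `stepE` (tree). Joint sufficiency is kernel-checked (no `_of` glue to smuggle a gap).
Definitions checked: `liouvilleSum x = Σ_{n ∈ Ioc 0 ⌊x⌋₊} λ n` (= the stubs' `Icc 1 y` sums),
`mertensFunction` likewise, `QuasiRiemannHypothesis σ₀ = no zero with σ₀ < Re s < 1`.

* `stub_B` (exact identity, characters mod `p`): TRUE. Orthogonality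
  `1_{k ≡ -1 (p)} = (p-1)^{-1} Σ_χ χ(-1)χ(k)` (`χ(-1) = ±1` is its own inverse), principal term
  `Σ_{k ≤ y, p ∤ k} λ(k) = L(y) - λ(p) L(⌊y/p⌋) = L(y) + L(⌊y/p⌋)` by complete multiplicativity;
  `p = 2`: no non-principal character, identity reads `Σ_{k odd} λ = L(y) + L(⌊y/2⌋)` ✓.
  Numerically verified (this seat, exact integers, p ∈ {2,3,5,7,11,13}, y ≤ 400): the principal
  identity `(p-1)·Σ_{k≤y,p∣k+1} λ(k) - (L(y)+L(⌊y/p⌋)) = Σ_{χ≠χ₀} χ(-1) S_χ(y)` checked through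
  its character-free equivalent `Σ_{k≤y, p∤k} λ(k) = L(y) + L(⌊y/p⌋)` and the class-count form.
* `stub_D` (`λ → μ`): TRUE: `M(x) = Σ_{d ≤ √x} μ(d) L(x/d²)`; `Σ_d d^{-2(1-δ)} < ∞` iff `δ < 1/2`
  (the stub's `δ < 1/2` is exactly what is needed — SHARP, cannot be relaxed to `δ ≤ 1/2` with
  the same exponent), small `x/d² < x₀` part `≤ x₀ √x ≤ x₀ x^{1-δ}`.
* `stub_C` (assembly): TRUE from `hA`, `hV` + tree (`sum_inv_primes_window_ge`):
  `L(y)·Σ_{N<p≤2N} (p-1)^{-1} = Q_N(y) - R_N(y) - Σ_p L(⌊y/p⌋)/(p-1)`, last term `≤ y/(N+1)`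
  trivially, `N = ⌊y^θ⌋`, so `|L(y)| ≪ log y · y^{1-min(θδ₁, δ₂, θ)}`; `N ≥ 2` and `N² ≤ y`
  hold for `θ ≤ 1/4`, `y ≥ y₀`. Real `x`: `L(x) = L(⌊x⌋)`.
* `stub_A` (the ONLY use of the crux; `c = -1`, 0/1 coefficients): TRUE given the crux — and
  meanwhile LANDED by the lead (`Theorems/LiouvilleMADTypeIILiouvilleStubA.lean`, via the route's
  Vaughan-engine pieces `TypeIIToLevel.typeII_rect` / `abs_block_le`, `δ₁ = min(η,1/2)/2`). Paper
  bookkeeping for the record: `Q_N(y) = Σ_{p∼N} Σ_{1 ≤ m ≤ (y+1)/p} λ(mp-1)`; (i) `m = 1` lies in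
  no box `(M,2M]`: its contribution is `≤ π(2N) ≤ 2N ≤ 2y^{1/2}`; (ii) full boxes
  `M ∈ [N, (y+1)/(4N)]`: crux with `β = 1_primes`, `α = 1`: `≪ MN(N^{-1/2} + M^{-η})`, dyadic sum
  `≪ y(N^{-1/2} + N^{-η})` using `y/N ≥ N`; (iii) `M < N`: swap the roles of `m` and `p` (the crux
  at `(M_long, N_short) = (N, M)`, legitimate since `M ≤ N`): `≪ N^{3/2} + N^{2-η}
  ≤ y(N^{-1/2} + N^{-η})`; (iv) the ≤ 3 dyadic ranges cut by `mp ≤ y+1`: split the primes into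
  `K = min(N^{1/3}, M^{2η/3})` blocks, cut `m` at `(y+1)/P_{j+1}`; Cauchy–Schwarz over blocks loses
  `√K`, the cut region costs `y/K`: total `≪ y(N^{-1/3} + M^{-2η/3})`. No junk: `mp - 1 ≥ 1`.
* `stub_U2` (zero-free box of constant width ⇒ power saving for `Σ λχ`): TRUE (standard:
  truncated Perron at `T = N^ε` costs `N^{1-ε+o(1)}`; on `Re s = 1 - δ₀/2`, Borel–Carathéodory
  from the zero-free box `[1-δ₀,1] × [-(N^ε+1), N^ε+1]` gives `1/L(s,χ) ≪ (qT)^{A(δ₀)}`,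
  `L(2s,χ²)` is harmless since `Re 2s ≥ 3/2`; with `q ≤ N^{ε/2}` the shifted integral is
  `N^{1-δ₀/2 + O(A ε)}`; choose `ε = ε(δ₀)` small). Imprimitive `χ`: extra Euler factors vanish
  only on `Re s = 0`. `q = 1`: `χ ≠ 1` is vacuous. Uniformity in `q, χ` ✓ (convexity bound for
  `L(s,χ)` is uniform).
* `stub_V` (non-principal remainder over `p ∈ (N,2N]`, `N ≍ y^θ`): TRUE with the order of
  choices `δ₀ := min(1/4, 1/(7c_B))` (`c_B` = exponent constant of the tree's log-free density
  theorem) → `ε = ε(δ₀)` from `hU2` (applied with its `N := y`, `q := p ≤ 2y^θ ≤ y^{ε/2}`) →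
  `θ := ε/4`: good characters cost `(1/N)·N²·C y^{1-ε/2} = C y^{1-ε/4}`; bad characters (a zero
  in the box; `≪ (P² T)^{c_B δ₀} = y^{O(δ₀ ε)}` of them by log-free density with `P = 2y^{ε/4}`,
  `T = y^ε + 1 ≤ P⁶`) cost `y/N = y^{1-ε/4}` each: total `y^{1 - ε(1/4 - 3c_Bδ₀/2)}`. NOTE for
  the lead: the saving exists ONLY because `θ` is chosen after `ε` and `δ₀` small w.r.t. the
  density constant — keep `∃ θ` innermost as filed.
* SHARPNESS remarks (not defects): `stub_C` needs `Σ_{N<p≤2N} 1/(p-1) ≫ 1/log N` (Chebyshev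
  lower bound; Bertrand alone loses `y^θ`); `stub_A`'s range `y ≥ N²` is used in (ii)/(iii).

## §4 WHY THE CRUX RESISTS (near-misses; none is formalisable as `¬ TypeIILiouville` today)

* A refutation needs, for ONE `c ≠ 0` and EVERY `η > 0`, boxes with
  `‖A‖_op ≥ ω(1)·max(√M, √(MN) M^{-η})`, i.e. an infinite family with `N → ∞` and operator norm
  `√(MN)·M^{-o(1)}` — essentially NO cancellation of `λ(mn+c)` against some rank-one test at
  power scales. The only known mechanism is a Landau–Siegel character (`λ ≈ χ` on the box:
  then §2(c) applies verbatim), whose existence is open; cf. barrier note B1 of IdeatorMemo1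
  (`TypeIIStructured → ¬UnboundedSiegelZeros`, judged not provable from the tree's
  `UnboundedSiegelZeros` because `q` and the quality are uncoupled — PICKED.md).
* Ω-route: `α = β = 1`, `M = N` needs `Σ_k λ(k) r_M(k) = Ω(M^{2-ε})` for every `ε`
  (`r_M` = restricted divisor function), i.e. zeros of `ζ` accumulating at `Re s = 1` — exactly
  the hypothesis of the lead's `TypeIILiouville_false_of_zetaZerosNearOne`; unprovable.
* Algebraic families (`mn + 1 = □` on `(k-1)(k+1)`, Pell families) are permutation-sparse:
  operator norm `O(1)`, useless against `√M`.
* Numerics (IdeatorMemo1 §2, kit j015303): `σ₁/(√M+√N) ∈ [0.977, 1.003]` for `M = 2048`,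
  `N ≤ 512`, `c ∈ {1,-1,2}` — the random-matrix value; nothing structured to amplify.
  THIS SEAT, kit j017957 (numerics/typeII_variance.py, λ sieved to 1.9·10⁸, 51 s): for
  `c ∈ {1,-1,2}`, `M ∈ {2¹⁴, 2¹⁶, 2¹⁷}`, `N ∈ {8,16,…,256,⌊√M⌋}` (54 boxes):
  `V_c(M,N)/(MN) ∈ [0.978, 1.016]` (random ±1 calibration `[0.997, 1.000]`),
  `σ₁/(√M+√N) ∈ [0.990, 1.002]` (random `[0.996, 1.000]`), `σ₁/√(MN) ≤ 1.09·N^{-1/2}`,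
  `max_{n≠n'}|S(n,n')|/√M ∈ [1.2, 4.8]` (random `[1.7, 4.5]`): the β = 1 variance test of §2(d)
  and the full operator norm sit exactly at the random-matrix value up to `M = 131072`; no drift
  in `M`, no dependence on `c`.
* Negatives index / barrier catalogue (`Literature/Barriers/Parity/*`): no entry asserts the
  falsity of bilinear `λ(mn+c)` bounds; `SelbergParityBarrier`, `FordMaynardMinimalTypeII`,
  `CircleMethodBinary` constrain METHODS (Type-I/sieve classes), not the truth of the crux.
-/

end Summit.Parity.GeneralizedHardyLittlewood.Cruxes.TypeIILiouville.Disproof
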